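import Literature.Claims.NS.ClayVariants
import HarnessLib

/-!
# Claim skeleton (D-0090 NS-CLAIMS, C80; T3 QUICK TRANCHE): Tarver 2016 — «Existence and
# Smoothness of the Navier-Stokes Equation in Two and Three-Dimensional Euclidean Space»

Typed skeleton of Tim Tarver, *Existence and Smoothness of the Navier-Stokes Equation in Two and
Three-Dimensional Euclidean Space*, Journal of Physical Mathematics 7:2 (2016) art. 1000167,
doi:10.4172/2090-0902.1000167 (7 pp.; PDF page = printed page) = bib `Tarver2016`, text of record of
cell `ns-claims` row C80 (sources `run/shared/lean/pub/ns-claims/sources/Tarver2016/`; renders read by the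
typist). UNREFEREED CLAIM under adjudication — NOTHING in this file asserts a step of the paper: the
paper's statements are `def … : Prop`; the `theorem`s are the kernel composition of the paper's own
chain (`claim_of_steps`), the Clay identification (`claimedTheorem_iff_clayA`) and plumbing. Verdict
vocabulary is the refuter's / referee's. QUICK statement grain (cell RULINGS v1.29l (4)).

## The claimed statement, as printed (p.2, col. 1, l.1–7)
«The goal here is to prove letter A in the paper that states solutions of the Navier-Stokes equation
exist on ℝ³. Lets take ν > 0 and n = 3. Let u⃗°(x) be any smooth, divergence-free vector field satisfying
equation 4 stated in the proposal of C. Fefferman. We will also take f⃗ᵢ(x,t) to be equal to zero. Then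
there exists smooth functions p(x,t) and u⃗ᵢ(x,t) on ℝ³ × [0,∞) that satisfy equations 1, 2, 3, 6,
and 7.» (Abstract p.1 / Conclusion p.7: «In three space dimensions and time, given an initial velocity
vector, there exists a velocity field and scalar pressure field which are both smooth and globally
defined that solve the Navier-Stokes equations.») This is Clay (A) token for token: `ClaimedTheorem`
below is stated in the `ClayVariants` vocabulary and `claimedTheorem_iff_clayA : ClaimedTheorem ↔
clayR3.Regularity` is `Iff.rfl`. Delta to Clay: **none on every axis** (Δ1 ℝ³ · Δ2 (1)–(3) · Δ3 f ≡ 0 ·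
Δ4 (4) · Δ5 (6) ∧ (7) · Δ6 ∀ data ∃ global smooth solution · Δ7 ν > 0). (The Introduction p.1 speaks of
a «given constant applied force»; the statement on p.2 sets f ≡ 0.)

## The printed chain (pp.2–7) and the ordered Step index (`claim_of_steps` consumes Steps 2, 3)
The body consists of Newton's-law rearrangements of (1) (pp.1–2, (4)–(8)), quoted textbook material on
linear equations (transport equation and Goursat problem p.3; THEOREM 1 p.3 = Poisson–Kirchhoff formula
for the 3-D wave equation `Σⱼ ∂²u⃗ᵢ/∂xⱼ² − (1/v²) ∂²u⃗/∂t² = 0`; stationary plane flows with a stream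
function, Kolmogorov flow, 1-D Euler, THEOREM 2 p.4 = Green's-function formula for the forced 1-D wave
equation with Dirichlet data; shock waves, periodic strings, «strict»/«generalized» solutions and Fourier
sine partial sums pp.5–6), the identification of the NS velocity with a solution of «The Simple Wave
equation» (p.6), its solution by Poisson's formula (pp.6–7), and a closing stream-function manipulation
(p.7). In print order:
* Step 1 = `NSIsWave` — p.6 col.2: «there could exist a wave function u⃗(x,t) of a particle that
  satisfies … ∂u⃗ᵢ/∂t = v∇u⃗ᵢ … Now we take the a second derivative of u⃗ᵢ such that ∂²u⃗ᵢ/∂t² = v∇²u⃗ᵢ,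
  which is also known as "The Simple Wave equation" … ∂²u⃗ᵢ/∂t² = νΔu⃗ᵢ», echoed p.3 col.2 «Therefore,
  the given u⃗(x,t) is a solution of the three-dimensional wave equation satisfying the given
  conditions [4]»: the NS velocity field satisfies `∂ₜ²u = νΔu`. The paper's JUSTIFICATION for treating
  the velocity as a wave solution; NOT consumed by `claim_of_steps` (erratum-column candidate; the
  refuter may cite it as the feeder of Step 3).
* Step 2 = `WaveCauchy` — Theorem 1 p.3 (Poisson–Kirchhoff) with «Smoothness» p.4 col.2 – p.5 («The
  solution to the three-dimensional wave equation … is of class C² … the solution is smooth for all t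
  as the initial data») and pp.6–7 («This Simple Wave equation can be solved in three dimensions with
  the initial conditions u⃗(x,y,z,0) = φ, ∂u⃗/∂t(x,y,z,0) = ψ … Poisson's formula»): the Cauchy problem
  for `∂ₜ²U = νΔU` with smooth data has a global smooth solution. Classical; typed, not attacked.
* Step 3 = `WaveGivesNS` — p.5 col.2 («We have our given velocity field u⃗ and let our scalar pressure
  field be p(x,t) be equal to a function gᵢ(x,t) … with initial data … ∂u⃗/∂t(x,0) = 0»), p.6 col.1–2
  («We must now show that p and u⃗ is infinitely differentiable on the set ℝⁿ × [0,∞) … This confirms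
  equation six … Equation seven is of bounded energy or global regularity»), p.7 («we have the solution
  to the three-dimensional simple wave equation where u⃗ = φ and u⃗ₜ = ψ initially … Since the pressure
  p is being eliminated and the stream function exists, the velocity u⃗ exists [11,12]»): the smooth
  global wave solution issued from the datum (with `∂ₜU(·,0) = 0`) IS a Navier–Stokes velocity — some
  smooth pressure makes `(U, p)` solve (1)–(3) with f ≡ 0 — and has bounded energy. LOAD-BEARING.
  `WaveGivesNSAbs` is its HYGIENE-13 companion over all smooth divergence-free data (the printed
  argument uses no decay of the datum anywhere).
COMPOSITION: `claim_of_steps : WaveCauchy → WaveGivesNS → ClaimedTheorem` (PROVED).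

## References
* T. Tarver, J. Phys. Math. 7:2 (2016) 1000167 (`Tarver2016`): abstract p.1; statement p.2 col.1
  l.1–7; (4)–(8) pp.2–3; «Existence» p.3 (Theorem 1); p.4 (stream function, Theorem 2); «Smoothness»
  pp.4–6; «Analysis of the Navier-Stokes equation» p.6; wave reduction p.6 col.2; Poisson formula and
  stream-function elimination p.7; Conclusion p.7.
* Cell files: `claims/Tarver2016/CARD.md` (typist-1 g2; PREDICTION 2026-08-27T01:35:58Z),
  `sources/Tarver2016/LOCATORS.md` (lit-1 g2).

WHAT THIS IS NOT: not a claim about NS regularity or blow-up; not a claim about any author beyond the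
typed locator.
-/

noncomputable section

open Set
open scoped ContDiff
open Laplacian

namespace Literature.Claims.NS.Tarver2016

open Literature.Analysis.FluidPDE Literature.Claims.NS.ClayVariants

/-- Physical space `ℝ³`. [folklore] -/
abbrev R3 : Type := EuclideanSpace ℝ (Fin 3)

/-- `U` solves «The Simple Wave equation» `∂²U/∂t² = νΔU` (p.6 col.2; p.3 col.1 display
`Σⱼ ∂²u⃗ᵢ/∂xⱼ² − (1/v²) ∂²u⃗/∂t² = 0`) at every `t > 0`, `x ∈ ℝ³` (second time derivative in the open
half-line; smoothness up to `t = 0` is carried separately by `IsSmoothOnHalfSpace`).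
[cite: Tarver2016, p.6 col.2; p.3 col.1] -/
def IsWaveSolution (ν : ℝ) (U : ℝ → R3 → R3) : Prop :=
  ∀ t : ℝ, 0 < t → ∀ x : R3, iteratedDeriv 2 (fun s => U s x) t = ν • (Δ (U t)) x

/-! ## The claimed statement -/

/-- **CLAIMED THEOREM (p.2 col.1 l.1–7, = Clay (A) as printed)**: for every `ν > 0` and every smooth
divergence-free datum `u⃗°` of class (4), with `f ≡ 0`, there are smooth `p`, `u⃗` on `ℝ³ × [0,∞)`
satisfying (1), (2), (3), (6) and (7). [claim: Tarver2016, status: under-review] [cite: Tarver2016, p.2 col.1 l.1–7; abstract p.1; Conclusion p.7] -/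
def ClaimedTheorem : Prop :=
  ∀ ν : ℝ, 0 < ν → ∀ u₀ : R3 → R3, ContDiff ℝ ∞ u₀ → NSWave0.IsDivFree u₀ → HasRapidSpatialDecay u₀ →
    ∃ (u : ℝ → R3 → R3) (p : ℝ → R3 → ℝ),
      IsSmoothOnHalfSpace u ∧ IsSmoothOnHalfSpace p ∧ IsNavierStokesSolution ν 0 u₀ u p ∧
        HasBoundedEnergy u

/-- **Delta to Clay = none**: the printed statement is Clay (A) (`clayR3.Regularity`) token for token.
[cite: Tarver2016, p.2 col.1 l.1–7] -/
theorem claimedTheorem_iff_clayA : ClaimedTheorem ↔ clayR3.Regularity := Iff.rfl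

/-- Schema form of the identification (cell TYPING-HYGIENE 10(b)). [cite: Tarver2016, p.2 col.1 l.1–7] -/
theorem clay_of_claimed (h : ClaimedTheorem) : clayR3.Regularity := claimedTheorem_iff_clayA.mp h

/-! ## The Steps (none asserted) -/

/-- **Step 1 — the NS velocity satisfies the wave equation** (p.6 col.2 «∂u⃗ᵢ/∂t = v∇u⃗ᵢ … ∂²u⃗ᵢ/∂t² =
v∇²u⃗ᵢ, which is also known as "The Simple Wave equation" … ∂²u⃗ᵢ/∂t² = νΔu⃗ᵢ»; p.3 col.2 «Therefore,
the given u⃗(x,t) is a solution of the three-dimensional wave equation satisfying the given conditions»):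
every smooth solution `(u, p)` of (1)–(3) with `f ≡ 0` on `ℝ³ × [0,∞)` satisfies `∂ₜ²u = νΔu` for
`t > 0`. The feeder of Step 3; not consumed by `claim_of_steps`. [claim: Tarver2016, status: under-review] [cite: Tarver2016, p.6 col.2; p.3 col.2] -/
def NSIsWave : Prop :=
  ∀ (ν : ℝ) (u₀ : R3 → R3) (u : ℝ → R3 → R3) (p : ℝ → R3 → ℝ), 0 < ν →
    IsSmoothOnHalfSpace u → IsSmoothOnHalfSpace p → IsNavierStokesSolution ν 0 u₀ u p →
      IsWaveSolution ν u

/-- **Step 2 — the wave Cauchy problem is globally, smoothly solvable** (THEOREM 1 p.3, Poisson–Kirchhoff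
spherical means «belongs to C² in −∞ < (x,t) < ∞, and is a solution of the Cauchy problem»; «Smoothness»
p.4 col.2 «For m = 1 the solution is smooth for all t as the initial data»; pp.6–7 «This Simple Wave
equation can be solved in three dimensions with the initial conditions u⃗(x,y,z,0) = φ(x,y,z),
∂u⃗/∂t(x,y,z,0) = ψ(x,y,z) … Poisson's formula»): for smooth `φ, ψ` there is `U`, smooth on
`ℝ³ × [0,∞)`, solving `∂ₜ²U = νΔU` with `U(0) = φ`, `∂ₜU(0) = ψ`. Classical (not attacked).
[claim: Tarver2016, status: under-review] [cite: Tarver2016, Theorem 1 p.3; p.4 col.2; pp.6–7] -/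
def WaveCauchy : Prop :=
  ∀ (ν : ℝ) (φ ψ : R3 → R3), 0 < ν → ContDiff ℝ ∞ φ → ContDiff ℝ ∞ ψ →
    ∃ U : ℝ → R3 → R3, IsSmoothOnHalfSpace U ∧ IsWaveSolution ν U ∧ U 0 = φ ∧
      ∀ x : R3, derivWithin (fun s => U s x) (Ici 0) 0 = ψ x

/-- **Step 3 — the wave solution from the datum is the Navier–Stokes solution** (p.5 col.2 «We have our
given velocity field u⃗ and let our scalar pressure field be p(x,t) be equal to a function gᵢ(x,t)» with
initial data «∂u⃗/∂t(x,0) = 0»; p.6 «This confirms equation six … Equation seven is of bounded energy or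
global regularity»; p.7 «we have the solution to the three-dimensional simple wave equation where u⃗ = φ
and u⃗ₜ = ψ initially … Since the pressure p is being eliminated and the stream function exists, the
velocity u⃗ exists [11,12]»): for every `ν > 0` and every smooth divergence-free datum `u₀` of class
(4), every smooth global solution `U` of `∂ₜ²U = νΔU` with `U(0) = u₀`, `∂ₜU(0) = 0` admits a smooth
pressure `p` with `(U, p)` solving (1)–(3), `f ≡ 0`, and `U` has bounded energy (7). LOAD-BEARING.
[claim: Tarver2016, status: under-review] [cite: Tarver2016, p.5 col.2; p.6 col.1–2; p.7 col.1–2] -/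
def WaveGivesNS : Prop :=
  ∀ (ν : ℝ) (u₀ : R3 → R3) (U : ℝ → R3 → R3), 0 < ν →
    ContDiff ℝ ∞ u₀ → NSWave0.IsDivFree u₀ → HasRapidSpatialDecay u₀ →
    IsSmoothOnHalfSpace U → IsWaveSolution ν U → U 0 = u₀ →
    (∀ x : R3, derivWithin (fun s => U s x) (Ici 0) 0 = 0) →
      ∃ p : ℝ → R3 → ℝ, IsSmoothOnHalfSpace p ∧ IsNavierStokesSolution ν 0 u₀ U p ∧ HasBoundedEnergy U

/-- **Step 3 at the ABSTRACT GRAIN (HYGIENE 13 companion)**: the same inference for every smooth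
divergence-free datum — the printed argument (pp.5–7) uses no decay of `u⃗°` anywhere; the energy clause
is dropped with the decay. [claim: Tarver2016, status: under-review] [cite: Tarver2016, p.5 col.2; p.6 col.1–2; p.7 col.1–2] -/
def WaveGivesNSAbs : Prop :=
  ∀ (ν : ℝ) (u₀ : R3 → R3) (U : ℝ → R3 → R3), 0 < ν →
    ContDiff ℝ ∞ u₀ → NSWave0.IsDivFree u₀ →
    IsSmoothOnHalfSpace U → IsWaveSolution ν U → U 0 = u₀ →
    (∀ x : R3, derivWithin (fun s => U s x) (Ici 0) 0 = 0) →
      ∃ p : ℝ → R3 → ℝ, IsSmoothOnHalfSpace p ∧ IsNavierStokesSolution ν 0 u₀ U p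

/-! ## Kernel composition and plumbing -/

/-- **COMPOSITION** (pp.6–7: solve the Simple Wave equation from the datum by Poisson's formula, then
«Since the pressure p is being eliminated and the stream function exists, the velocity u⃗ exists»):
Step 2 with `φ = u⃗°`, `ψ = 0` and Step 3 give the claimed theorem. [cite: Tarver2016, pp.6–7] -/
theorem claim_of_steps (h₂ : WaveCauchy) (h₃ : WaveGivesNS) : ClaimedTheorem := by
  intro ν hν u₀ hs hdiv hdec
  obtain ⟨U, hU, hwave, h0, h1⟩ := h₂ ν u₀ (fun _ => 0) hν hs contDiff_const
  obtain ⟨p, hp, hns, hE⟩ := h₃ ν u₀ U hν hs hdiv hdec hU hwave h0 h1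
  exact ⟨U, p, hU, hp, hns, hE⟩

/-- The abstract-grain Step 3 implies the pressure/NS part of Step 3 for Clay data (the energy clause (7)
is separate). [cite: Tarver2016, p.5 col.2; p.7] -/
theorem ns_of_waveGivesNSAbs (h : WaveGivesNSAbs) {ν : ℝ} {u₀ : R3 → R3} {U : ℝ → R3 → R3}
    (hν : 0 < ν) (hs : ContDiff ℝ ∞ u₀) (hdiv : NSWave0.IsDivFree u₀) (hU : IsSmoothOnHalfSpace U)
    (hwave : IsWaveSolution ν U) (h0 : U 0 = u₀)
    (h1 : ∀ x : R3, derivWithin (fun s => U s x) (Ici 0) 0 = 0) :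
    ∃ p : ℝ → R3 → ℝ, IsSmoothOnHalfSpace p ∧ IsNavierStokesSolution ν 0 u₀ U p :=
  h ν u₀ U hν hs hdiv hU hwave h0 h1

end Literature.Claims.NS.Tarver2016

end

-- WHAT THIS IS NOT: not a claim about NS regularity or blow-up; not a claim about any author beyond the
-- typed locator.
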